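import Summits.BirchSwinnertonDyer.Rank1Residual.Ordinary.Conjectures.KolyvaginKimDatumOfEulerSystem
import HarnessLib

/-!
# C-16's per-letter clause from an Euler system of `T_3E` with THEOREM D's `E(ℚ₃)[3] = 0` certificate DISCHARGED from the letter
# (companion of `KolyvaginKimDatumOfEulerSystem.lean`; theorems only; nothing asserted; C-16 stays a CONJECTURE)

HONEST FRAMING (cell `b2b-bsdres`, run/shared/lean/b2b/bsd-rank1-residual/, verbatim in every
file): the goal of the cell is to DELETE the COMBINATION-SHAPED residual classes of the
Birch–Swinnerton-Dyer formula for ALL analytic-rank `≤ 1` elliptic curves over `ℚ` — "full BSD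
formula for every rank `≤ 1` curve in class `C`" assembled STRICTLY from published theorems — so
that the rank-`≤ 1` remainder becomes exactly the CONSTRUCTION-SHAPED classes, which are TYPED
(missing-input `Prop`s), NOT attempted. This is not "finishing BSD". Seat `b2b-bsdres-additive-p3`
(X8 prover B / X7 joint; typer-designate for the cell conjecture C-16 = hyp C120.1; ladder BSD:K3 hand-off to cell
`bsd-ssimc`, last generation before the D-0075 sunset). This file books nothing and moves no mark; X7 / X8 stay
CONSTRUCTION-SHAPED; C-16 = CONJECTURE. NO Euler system is asserted to exist (binder `hc` inside `h`).

## What this file does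

`KolyvaginKimDatumOfEulerSystem.lean` (F31) §2 `kuriharaExactOrderAt_of_isEulerSystem_torsionCoeff` derives C-16's clause at
`(ℓ, k₀)` on its letter from an Euler system of `T_3E` with n1011's THEOREM D binders displayed, among them the place-`3`
certificate `htors₃ : E(ℚ_v)[3] = 0` at `v ∣ 3` in the `adicCompletion` currency. On C-16's letter (`3` good, `a₃ ∉ {1, −2}`)
that certificate HOLDS: the chain's `forall_three_nsmul_eq_zero_padic_of_frobeniusTrace_three` (`Ordinary/LocalDivExponentPointOrder.lean`:
`E(ℚ₃)[3] = 0` on Mathlib's `ℚ_[3]`-points, AEC IV.6.1 + VII.2.1) transported along the chain's `E(ℚ_v) ≃+ E(ℚ₃)`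
(`exists_pointAddEquiv_adicCompletion_padic_comp`, `Ordinary/StrictSelmerIndexLetterAtThree.lean`). So:

* `forall_three_nsmul_eq_zero_adicCompletion_of_frobeniusTrace_three` — `E(ℚ_v)[3] = 0` at `v ∣ 3` on the letter, in THEOREM D's
  currency (useful to any consumer of n1011's `…_three_of_torsion_eq_zero*` ENDs on good non-anomalous rows);
* `kuriharaExactOrderAt_of_isEulerSystem_torsionCoeff_letter` — F31 §2 with `htors₃` discharged. Remaining curve-level binders
  of THEOREM D: `hbad` (`E(ℚ_w)[3] = 0` at the bad `w ≠ 3` — NOT a clause of C-16's letter) and the reduction maps `rd`.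

References: J. H. Silverman, AEC (2009) IV.6.1, VII.2.1 [SilvermanAEC2009]; B. Mazur, K. Rubin, Mem. AMS 799 (2004) Thm. 3.2.4,
5.2.12, App. A [MazurRubin2004]; C.-H. Kim, arXiv:2203.12159 Thm. 3.13, (5.3) [Kim2022StructureSelmer]; R. Sakamoto, JTNB 36 (2024)
Def. 4.1 [Sakamoto2024]; J. S. Milne, ADT (2006) I 2.8, 4.10(b) [MilneADT2006].
-/

noncomputable section

open CategoryTheory Function Finset Field IsDedekindDomain
open scoped NumberField Classical ContRepresentation MatrixGroups
open CongruenceSubgroup WeierstrassCurve Literature.NumberTheory.EllipticCurves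
  Literature.NumberTheory.EllipticCurves.ModularForms
  Literature.NumberTheory.EllipticCurves.Rank1Residual
  Literature.NumberTheory.GaloisRepresentations Literature.NumberTheory.GaloisCohomology
  Literature.NumberTheory.GaloisRepresentations.DiscreteGaloisModule
  NumberField
  Summit.BirchSwinnertonDyer.Rank1Residual.GaloisImage
  Summit.BirchSwinnertonDyer.Rank1Residual.GaloisImage.CoeffTransport
  Summit.BirchSwinnertonDyer.Rank1Residual.GaloisImage.CyclotomicLevel
  Summit.BirchSwinnertonDyer.Rank1Residual.GaloisImage.TorsionCoeff
  Rat.HeightOneSpectrum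

namespace Summit.BirchSwinnertonDyer.Rank1Residual.Ordinary

variable (W : WeierstrassCurve ℚ) [W.IsElliptic] [W.IsGloballyMinimal]
variable [Module.Free ℤ_[3] (W.tateModule 3)] [Module.Finite ℤ_[3] (W.tateModule 3)]
  [ContinuousSMul ℤ_[3] (W.tateModule 3)]

/-- Local notation: `T∞ = T_3 E` as a continuous `G_ℚ`-representation (as in n1011's THEOREM D files). -/
local notation3 "T∞" => WeierstrassCurve.tateGaloisRep W 3 (W.continuous_galoisRepTate_holds 3)

/-- Local notation: `𝐃ℤ⟦X, U, τ⟧ ℓ = ∑_{j < ℓ−1} j·(τ_ℓ)_*^j` on `H¹(U, X)` (`ℤ`-linear), Kolyvagin's derivative operator. -/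
local notation3 (prettyPrint := false) "𝐃ℤ⟦" X ", " U ", " τ "⟧" =>
  fun ℓ : HeightOneSpectrum (𝓞 ℚ) =>
  ∑ j ∈ Finset.range (((primesEquiv ℓ : Nat.Primes) : ℕ) - 1),
    (j : Module.End ℤ (continuousCohomology 1 (subgroupRep X U))) *
      (conjMap X U ((τ : HeightOneSpectrum (𝓞 ℚ) → absoluteGaloisGroup ℚ) ℓ) 1).hom.toLinearMap ^ j

/-- Local notation: the level-`j` reduction `red_j : T_3E ⟶ E[3^j]_{ℤ_3}` (n1011 GZ-2). -/
local notation3 "𝐫𝐞𝐝⟦" j "⟧" => tateModuleRed W 3 (W.continuous_galoisRepTate_holds 3) j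

/-! ### §3 The letter's `E(ℚ₃)[3] = 0` in the `adicCompletion` currency; §2 with `htors₃` discharged -/

section LetterTorsion

omit [Module.Free ℤ_[3] (W.tateModule 3)] [Module.Finite ℤ_[3] (W.tateModule 3)]
  [ContinuousSMul ℤ_[3] (W.tateModule 3)] in
/-- **`E(ℚ_v)[3] = 0` at the place `v ∣ 3` on C-16's letter** (`3` good, `a₃ ∉ {1, −2}`), in the `adicCompletion` currency of
THEOREM D's binder `htors₃`: the chain's `forall_three_nsmul_eq_zero_padic_of_frobeniusTrace_three` (`E(ℚ₃)[3] = 0` on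
Mathlib's `ℚ_[3]`-points; AEC IV.6.1 + VII.2.1) transported along `E(ℚ_v) ≃+ E(ℚ₃)`
(`exists_pointAddEquiv_adicCompletion_padic_comp`). [cite: SilvermanAEC2009, IV.6.1 and Prop. VII.2.1] -/
theorem forall_three_nsmul_eq_zero_adicCompletion_of_frobeniusTrace_three
    (hgood : W.HasGoodReductionAtPrime 3) (ha1 : W.frobeniusTrace 3 ≠ 1) (ha2 : W.frobeniusTrace 3 ≠ -2)
    (v : HeightOneSpectrum (𝓞 ℚ)) (hv : ((3 : ℕ) : 𝓞 ℚ) ∈ v.asIdeal)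
    (P : (W.baseChange (v.adicCompletion ℚ)).toAffine.Point) (hP : 3 • P = 0) : P = 0 := by
  obtain ⟨f, -⟩ := exists_pointAddEquiv_adicCompletion_padic_comp W (p := 3) hv
  have h3 : 3 • f P = 0 := by rw [← map_nsmul, hP, map_zero]
  exact f.injective
    (by rw [map_zero]; exact forall_three_nsmul_eq_zero_padic_of_frobeniusTrace_three W hgood ha1 ha2 (f P) h3)

variable {N : ℕ} (f : CuspForm (Gamma0 N) 2) (ℓ k₀ : ℕ) [Fact ℓ.Prime] (P : W.toAffine.Point) (F : ℕ)

/-- **C-16's clause at `(ℓ, k₀)` ON ITS LETTER from an Euler system of `T_3E` — §2 with THEOREM D's binder `htors₃` DISCHARGED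
from the letter** (`3` good, `a₃ ∉ {1, −2}` ⟹ `E(ℚ_v)[3] = 0` at `v ∣ 3`, `forall_three_nsmul_eq_zero_adicCompletion_of_frobeniusTrace_three`).
Remaining curve-level binders of THEOREM D: `hbad` (NOT a clause of the letter) and the reduction maps `rd`; everything else as in
`kuriharaExactOrderAt_of_isEulerSystem_torsionCoeff`. Nothing asserted; C-16 stays a CONJECTURE.
[cite: MazurRubin2004, Thm. 3.2.4, Thm. 5.2.12 and App. A] [cite: Kim2022StructureSelmer, Thm. 3.13 and (5.3)]
[cite: SilvermanAEC2009, IV.6.1 and Prop. VII.2.1] -/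
theorem kuriharaExactOrderAt_of_isEulerSystem_torsionCoeff_letter
    (hgood : W.HasGoodReductionAtPrime 3) (ha1 : W.frobeniusTrace 3 ≠ 1) (ha2 : W.frobeniusTrace 3 ≠ -2)
    (hm0 : ¬ O5.PointLocallyThreeDivisibleAt W 3 P) (hcycℓ : IsCyclicKolyvaginLevel W 3 ℓ)
    {vℓ v₃ : HeightOneSpectrum (𝓞 ℚ)} (hvℓ : (ℓ : 𝓞 ℚ) ∈ vℓ.asIdeal) (hv₃ : ((3 : ℕ) : 𝓞 ℚ) ∈ v₃.asIdeal)
    (hPT : poitouTate_sum_localTatePairing_eq_zero ℚ)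
    (hEPℓ : localEulerPoincareCharacteristic (vℓ.adicCompletion ℚ))
    (hEP₃ : localEulerPoincareCharacteristic (v₃.adicCompletion ℚ))
    (hsurj : W.HasSurjectiveModNGaloisRep ((3 : ℕ) : ℤ))
    (hbad : ∀ w : HeightOneSpectrum (𝓞 ℚ), ¬ W.HasGoodReductionAt w →
      ((primesEquiv w : Nat.Primes) : ℕ) ≠ 3 →
        ∀ P : (W.baseChange (w.adicCompletion ℚ)).toAffine.Point, 3 • P = 0 → P = 0)
    (rd : ∀ j : ℕ, (W.torsionGaloisModule (((3 : ℕ) : ℤ) ^ (j + 1) * ((3 : ℕ) : ℤ))).toContRepresentation →ⁱL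
      (W.torsionGaloisModule (((3 : ℕ) : ℤ) ^ j * ((3 : ℕ) : ℤ))).toContRepresentation)
    (hrd : ∀ (j : ℕ) (x : geomTorsion W (((3 : ℕ) : ℤ) ^ (j + 1) * ((3 : ℕ) : ℤ))),
      ((rd j x : geomTorsion W (((3 : ℕ) : ℤ) ^ j * ((3 : ℕ) : ℤ))) : geomPoints W) =
        ((3 : ℕ) : ℤ) • (x : geomPoints W))
    -- per surjective `ψ`: the depth, the unit, the Euler system, the canonical datum, the readings
    (h : ∀ ψ : (q : ℕ) → (ZMod q)ˣ →* Multiplicative (ZMod (3 ^ k₀)),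
      (∀ q ∈ ℓ.primeFactors, Function.Surjective (ψ q)) →
        ∃ (k : ℕ) (_ : k₀ ≤ k + 1) (_ : Kato.IsKolyvaginPrime W 3 (k + 1) ℓ) (u : ℕ) (_ : ¬ 3 ∣ u)
          (S : Set (HeightOneSpectrum (𝓞 ℚ)))
          (c : ∀ (i : ℕ) (r : (cyclotomicLevelsRat 3 S).Ideals), H1 T∞ ((cyclotomicLevelsRat 3 S).level i r.1))
          (_ : IsEulerSystem (cyclotomicLevelsRat 3 S) T∞ 3 c)
          (D : KolyvaginDatum (W.torsionGaloisModule (((3 : ℕ) : ℤ) ^ k * ((3 : ℕ) : ℤ))))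
          (_ : D.transverse = cyclotomicTransverse (W.torsionGaloisModule (((3 : ℕ) : ℤ) ^ k * ((3 : ℕ) : ℤ))))
          (η : (q : HeightOneSpectrum (𝓞 ℚ)) → (ZMod (Ideal.absNorm q.asIdeal))ˣ)
          (_ : D.HasCanonicalComparison (3 ^ (k + 1)) η)
          (hPr : D.primes ⊆ (cyclotomicLevelsRat 3 S).primes)
          (_ : ∀ q ∈ D.primes, Kato.IsKolyvaginPrime W 3 (k + 1) ((primesEquiv q : Nat.Primes) : ℕ))
          (Sτ : Set (HeightOneSpectrum (𝓞 ℚ))) (τ : absoluteGaloisGroup ℚ)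
          (_ : Nonempty (cokerSubOne (W.torsionGaloisModule (((3 : ℕ) : ℤ) ^ k * ((3 : ℕ) : ℤ))) τ ≃+
            ZMod (3 ^ (k + 1))))
          (_ : τ ∈ rootsOfUnityFixer ℚ (3 ^ (k + 1)))
          (_ : D.primes ⊆ frobeniusClassPrimes (W.torsionGaloisModule (((3 : ℕ) : ℤ) ^ k * ((3 : ℕ) : ℤ))) Sτ τ
            (3 ^ (k + 1)))
          (_ : vℓ ∈ D.primes)
          (hdiv : ∀ X : geomPoints W, ∃ R : geomPoints W, (((3 : ℕ) : ℤ) ^ k * ((3 : ℕ) : ℤ)) • R = X),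
          (letI := TorsionCoeff.torsionBy.padicIntModule 3 (k + 1) (WeierstrassCurve.geomPoints W)
            ∀ (σ : HeightOneSpectrum (𝓞 ℚ) → absoluteGaloisGroup ℚ)
              (Φ : ∀ r : Finset (HeightOneSpectrum (𝓞 ℚ)),
                continuousCohomology 1 (subgroupRep (torsionRepPadicInt W 3 (k + 1)).toTopRep
                  ((cyclotomicLevelsRat 3 S).level ⊥ r)) →+
                  continuousCohomology 1 (subgroupRep
                    (W.torsionGaloisModule (((3 : ℕ) : ℤ) ^ k * ((3 : ℕ) : ℤ))).toTopRep
                    ((cyclotomicLevelsRat 3 S).level ⊥ r)))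
              (comm : ∀ r : Finset (HeightOneSpectrum (𝓞 ℚ)),
                ((r : Finset _) : Set (HeightOneSpectrum (𝓞 ℚ))).Pairwise fun a b =>
                  Commute
                    (𝐃ℤ⟦(W.torsionGaloisModule (((3 : ℕ) : ℤ) ^ k * ((3 : ℕ) : ℤ))).toTopRep,
                      ((cyclotomicLevelsRat 3 S).level ⊥ r), σ⟧ a)
                    (𝐃ℤ⟦(W.torsionGaloisModule (((3 : ℕ) : ℤ) ^ k * ((3 : ℕ) : ℤ))).toTopRep,
                      ((cyclotomicLevelsRat 3 S).level ⊥ r), σ⟧ b))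
              (κ : Finset (HeightOneSpectrum (𝓞 ℚ)) →
                galoisCohomology (W.torsionGaloisModule (((3 : ℕ) : ℤ) ^ k * ((3 : ℕ) : ℤ))) 1),
              (∀ q, σ q ∈ (adicCompletionPrime ℚ q).inertia (absoluteGaloisGroup ℚ)) →
              (∀ q, modNCyclotomicCharacter ℚ (Ideal.absNorm q.asIdeal) (σ q) = η q) →
              (∀ r, ∀ (φ : contOneCocycles (subgroupRep (torsionRepPadicInt W 3 (k + 1)).toTopRep
                  ((cyclotomicLevelsRat 3 S).level ⊥ r)))
                (ψ' : contOneCocycles (subgroupRep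
                  (W.torsionGaloisModule (((3 : ℕ) : ℤ) ^ k * ((3 : ℕ) : ℤ))).toTopRep
                  ((cyclotomicLevelsRat 3 S).level ⊥ r))),
                (∀ g, ψ'.1 g = AddSubgroup.inclusion (geomTorsion_pow_succ_eq W 3 k).le (φ.1 g)) →
                  Φ r (oneCocycleClass _ φ) = oneCocycleClass _ ψ') →
              D.IsKolyvaginSystem (propagatedSelmerStructure W 3 k) κ →
              (∀ r : Finset (HeightOneSpectrum (𝓞 ℚ)), ¬ (↑r : Set _) ⊆ D.primes → κ r = 0) →
              (∀ (r : Finset (HeightOneSpectrum (𝓞 ℚ))) (hr : (↑r : Set _) ⊆ D.primes),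
                resSubgroup (W.torsionGaloisModule (((3 : ℕ) : ℤ) ^ k * ((3 : ℕ) : ℤ))).toTopRep
                    ((cyclotomicLevelsRat 3 S).level ⊥ r) 1 (κ r) =
                  (r.noncommProd 𝐃ℤ⟦(W.torsionGaloisModule (((3 : ℕ) : ℤ) ^ k * ((3 : ℕ) : ℤ))).toTopRep,
                      ((cyclotomicLevelsRat 3 S).level ⊥ r), σ⟧ (comm r))
                    (Φ r (ContinuousCohomology.map (ContinuousMonoidHom.id _)
                      (X := subgroupRep T∞.toTopRep ((cyclotomicLevelsRat 3 S).level ⊥ r))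
                      (Y := subgroupRep (torsionRepPadicInt W 3 (k + 1)).toTopRep
                        ((cyclotomicLevelsRat 3 S).level ⊥ r))
                      ((TopRep.resFunctor ((cyclotomicLevelsRat 3 S).level ⊥ r).subtype).map 𝐫𝐞𝐝⟦k + 1⟧) 1
                      (c ⊥ ⟨r, fun _ hq => hPr (hr (Finset.mem_coe.2 hq))⟩)))) →
              κ ∅ = kummerMapTorsion W (((3 : ℕ) : ℤ) ^ k * ((3 : ℕ) : ℤ)) hdiv ((3 ^ F * u) • P) ∧
              ∀ ψp : galoisCohomology ((W.torsionGaloisModule (((3 : ℕ) : ℤ) ^ k * ((3 : ℕ) : ℤ))).toLocal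
                    (Sum.inr v₃)) 1 ⧸
                  W.kummerSelmerStructure (((3 : ℕ) : ℤ) ^ k * ((3 : ℕ) : ℤ)) (Sum.inr v₃) ≃+ ZMod (3 ^ (k + 1)),
                (haveI : NeZero ℓ := ⟨(Fact.out : ℓ.Prime).ne_zero⟩
                 zmodPowOrd 3 k₀ (kuriharaNumber f (3 ^ k₀) ℓ ψ)) =
                  min k₀ (zmodPowOrd 3 (k + 1)
                    (ψp (galoisCohomology.localization (W.torsionGaloisModule (((3 : ℕ) : ℤ) ^ k * ((3 : ℕ) : ℤ)))
                      (Sum.inr v₃) 1 (κ {vℓ})))))) :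
    KuriharaExactOrderAt W f ℓ k₀ P F :=
  kuriharaExactOrderAt_of_isEulerSystem_torsionCoeff W f ℓ k₀ P F hgood ha1 ha2 hm0 hcycℓ hvℓ hv₃ hPT hEPℓ hEP₃ hsurj hbad
    (forall_three_nsmul_eq_zero_adicCompletion_of_frobeniusTrace_three W hgood ha1 ha2) rd hrd h

end LetterTorsion

end Summit.BirchSwinnertonDyer.Rank1Residual.Ordinary

end
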